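import Summits.QuantumFields.YangMills.Theorems.FluctuationComparisonRegPrIntLS2BetaRelativeLadderVarTwoSquare
import Literature.MathematicalPhysics.QuantumFieldTheory.Balaban1983to89.TorusHypercubicSymmetry
import HarnessLib

/-!
# S2β · (LIFT-V) §2b — THE `V`-ROW ALONG A COMB RUN: the two-square step ✓p830994 ITERATED `k` times (the far-rung pair difference after `k` squares ≤ the base pair
# difference + Σ over the run of the two rail pairs and the two relative plaquettes, with the induced composite transport), and the TRANSPORT-CHANGE price
# `2·dist1(P′P⁻¹)·dist1(chord)` — generic `P`, any `GaugeGroup`, exact group algebra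

Cell `ym3-torus` (rung R3 = continuum `SU(2)` Yang–Mills on the three-torus — NOT d = 4, NOT infinite volume, NOT a mass gap, NOT Clay).
Width seat «width 21» `ym3-torus-px21` (gen 24); `--kind proof --supports stmt-QuantumFields-20520 --as helper`, count-neutral, DEFINITION-FREE
(0 `def`, 0 `instance`, 0 `notation`, 0 `sorry`, default heartbeats); generic `P : Params`, ANY `GaugeGroup G`.

WHY (UV3-NODE §102 (px21 g24): the `V`-row recipe at `d = 3`; ★★OWNER №529 (SCT₂) = (LIFT-V); px10 g25 18:28:02Z «`E′ ≤ E′_comb + E′_nc`, each holder docks its own budget»).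
§102.2's only multi-step class (`μ = 1`, `ι = 2`: `k = |(x−c)₀| ≤ (L−1)∕2` squares down the axis-0 run to the COMB pair) is the two-square step ✓`dist1_farRungPair_le` iterated along
a run; THIS FILE packages the iteration once, for any run length and any group, so the `d = 3` chase (and any other dimension's) is a case split plus `exact`:
* §1 ★ `dist1_transport_change` — changing the transport of a pair difference from `P` to `P′` costs the commutator of `P′P⁻¹` with the transported chord:
  `dist1 (P′·c·P′⁻¹·d⁻¹) ≤ dist1 (P·c·P⁻¹·d⁻¹) + 2·dist1 (P′·P⁻¹)·dist1 c` under the standard `hcomm` (for a `U`-loop `P′P⁻¹` of `n` unit squares, `dist1 ≤ n·θ_abs`: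
  θ-suppressed — the `T₂₁` entry of the (W2) census, never `T₂₂`).
* §2 ★★★ `dist1_rungPair_run_le` — THE RUN: sites `zs i` with `zs (i+1) = (zs i) + e_κ` (hypothesis `hzs`, no iterate API), rung direction `e`, translate direction `τ`,
  transports `X 0 = Y`, `X (i+1) = W⟨zs i + e, κ⟩⁻¹·X i·W⟨zs i + τ + e, κ⟩` (hypothesis `hX`); then for every `k`
      `dist1 (X k·r′_k·(X k)⁻¹·r_k⁻¹) ≤ dist1 (Y·r′_0·Y⁻¹·r_0⁻¹) + Σ_{i<k} (rail pair S_i + rail pair S′_i + ρ_i + ρ′_i)`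
  (`r_i = U⟨zs i, e⟩⁻¹W⟨zs i, e⟩`, `r′_i` at `+ e_τ`; `S_i` the square at `zs i` with rail direction `κ`, rung direction `e`; rail pairs in ✓p830038's form) — induction on `k`
  over ✓`dist1_farRungPair_le`.  In §102.2: base pair = the COMB pair at `(x−c)₀ = 0` (lifted difference, ✓p829341 §3∕✓p829498 §4), every rail pair of the run is a pair of
  0-bonds (tree) — so `V^{(1)}_2(x) ≤ vT + k·(2vT + 2ρ)`, `k ≤ 2` at `L = 5`.
* §3 ★ `dist1_rungPair_run_le_of_transport` — §2 followed by §1: the same bound with ANY transport `P′` for the far pair, `+ 2·dist1(P′·(X k)⁻¹)·dist1(r′_k)`.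

HONEST SCOPE.  Group algebra along a lattice run; nothing of Bałaban's analysis is asserted or proved; the `d = 3` case split over ✓p828327's class (T), the aggregation over `READ′`,
(TOP-LAD)∕(LIFT-LAD′)∕(SCT₁₂₃), (ST)'s discharge, LOC, D-GUARD, GAP♯∘ (`stub_uniformFibreGapOrbit`, registry untouched, 0∕5), S2β, crux 20520 and `YM3TorusSU2` are NOT proved; no
registered stub is closed; rung R3 = SU(2) YM₃ on T³ — NOT d = 4, NOT infinite volume, NOT a mass gap, NOT Clay; the Yang–Mills mass gap is NOT proved.
References: T. Bałaban, CMP **122** (1989) 355–392 [Balaban1989LargeFieldII] (p.382); CMP **98** (1985) 17–51 [Balaban1985Averaging] ((9)–(10) p.19); CMP **99** (1985) 75–102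
[Balaban1985RegularSpaces] ((1.29) p.81).
-/

set_option autoImplicit false

namespace Summit.QuantumFields.YangMills.Theorems.FluctuationComparisonRegPrIntLS2BetaRelativeLadderVarRun

open Finset
open Literature.MathematicalPhysics.QuantumFieldTheory.Balaban1983to89
open Literature.MathematicalPhysics.QuantumFieldTheory.Balaban1983to89.T4Continuum
open Summit.QuantumFields.YangMills.Theorems.FluctuationComparisonRegPrIntLS2BetaRelativeLadderVarTwoSquare (dist1_farRungPair_le)

variable {P : Params} {j : ℕ} {G : Type*} [GaugeGroup G]

/-! ## §1 The transport-change price -/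

/-- ★ **TRANSPORT CHANGE**: `dist1 (P′·c·P′⁻¹·d⁻¹) ≤ dist1 (P·c·P⁻¹·d⁻¹) + 2·dist1 (P′·P⁻¹)·dist1 c` under the standard commutator hypothesis
(`P′cP′⁻¹d⁻¹ = [P′P⁻¹, PcP⁻¹]·(PcP⁻¹d⁻¹)`, `dist1 (PcP⁻¹) = dist1 c`). [folklore] -/
theorem dist1_transport_change (hcomm : ∀ g h : G, dist1 (g * h * g⁻¹ * h⁻¹) ≤ 2 * dist1 g * dist1 h) (P' P₀ c d : G) :
    dist1 (P' * c * P'⁻¹ * d⁻¹) ≤ dist1 (P₀ * c * P₀⁻¹ * d⁻¹) + 2 * dist1 (P' * P₀⁻¹) * dist1 c := by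
  have key : P' * c * P'⁻¹ * d⁻¹ = ((P' * P₀⁻¹) * (P₀ * c * P₀⁻¹) * (P' * P₀⁻¹)⁻¹ * (P₀ * c * P₀⁻¹)⁻¹) * (P₀ * c * P₀⁻¹ * d⁻¹) := by group
  rw [key]
  have h1 := GaugeGroup.dist1_mul_le ((P' * P₀⁻¹) * (P₀ * c * P₀⁻¹) * (P' * P₀⁻¹)⁻¹ * (P₀ * c * P₀⁻¹)⁻¹) (P₀ * c * P₀⁻¹ * d⁻¹)
  have h2 := hcomm (P' * P₀⁻¹) (P₀ * c * P₀⁻¹)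
  rw [GaugeGroup.dist1_conj] at h2
  linarith

/-! ## §2 The two-square step iterated along a run -/

/-- ★★★ **THE `V`-ROW ALONG A RUN**: sites `zs i` stepping in the rail direction `κ` (`zs (i+1) = zs i + e_κ`), rung direction `e`, translate direction `τ`; the rung chords
`r_i := U⟨zs i, e⟩⁻¹·W⟨zs i, e⟩` and their `τ`-translates `r′_i`; transports `X 0 = Y`, `X (i+1) = W⟨zs i + e, κ⟩⁻¹·X i·W⟨zs i + τ + e, κ⟩`.  Then for every `k`
    `dist1 (X k·r′_k·(X k)⁻¹·r_k⁻¹) ≤ dist1 (Y·r′_0·Y⁻¹·r_0⁻¹) + Σ_{i<k} (dist1 (rail pair S_i) + dist1 (rail pair S′_i) + dist1 (□_U⁻¹□_W)(S_i) + dist1 (□_U⁻¹□_W)(S′_i))`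
(induction on `k` over ✓`dist1_farRungPair_le`). [cite: Balaban1989LargeFieldII, p.382; Balaban1985Averaging, (9)-(10) p.19 (bookkeeping); Balaban1985RegularSpaces, (1.29) p.81] -/
theorem dist1_rungPair_run_le (W U : GaugeField P j G) (κ e τ : Fin P.d) (zs : ℕ → Site P j) (hzs : ∀ i, zs (i + 1) = (zs i).shift κ)
    (Y : G) (X : ℕ → G) (hX0 : X 0 = Y) (hX : ∀ i, X (i + 1) = (W ⟨(zs i).shift e, κ⟩)⁻¹ * X i * W ⟨((zs i).shift τ).shift e, κ⟩) (k : ℕ) :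
    dist1 (X k * ((U ⟨(zs k).shift τ, e⟩)⁻¹ * W ⟨(zs k).shift τ, e⟩) * (X k)⁻¹ * ((U ⟨zs k, e⟩)⁻¹ * W ⟨zs k, e⟩)⁻¹) ≤
      dist1 (Y * ((U ⟨(zs 0).shift τ, e⟩)⁻¹ * W ⟨(zs 0).shift τ, e⟩) * Y⁻¹ * ((U ⟨zs 0, e⟩)⁻¹ * W ⟨zs 0, e⟩)⁻¹) +
        ∑ i ∈ range k,
          (dist1 ((W ⟨(zs i).shift e, κ⟩ * (U ⟨(zs i).shift e, κ⟩)⁻¹) *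
              ((U ⟨zs i, κ⟩ * U ⟨(zs i).shift κ, e⟩ * (U ⟨(zs i).shift e, κ⟩)⁻¹ * (U ⟨zs i, e⟩)⁻¹ * U ⟨zs i, e⟩)⁻¹ * (U ⟨zs i, κ⟩ * (W ⟨zs i, κ⟩)⁻¹) *
                (U ⟨zs i, κ⟩ * U ⟨(zs i).shift κ, e⟩ * (U ⟨(zs i).shift e, κ⟩)⁻¹ * (U ⟨zs i, e⟩)⁻¹ * U ⟨zs i, e⟩))) +
            dist1 ((W ⟨((zs i).shift τ).shift e, κ⟩ * (U ⟨((zs i).shift τ).shift e, κ⟩)⁻¹) *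
              ((U ⟨(zs i).shift τ, κ⟩ * U ⟨((zs i).shift τ).shift κ, e⟩ * (U ⟨((zs i).shift τ).shift e, κ⟩)⁻¹ * (U ⟨(zs i).shift τ, e⟩)⁻¹ *
                    U ⟨(zs i).shift τ, e⟩)⁻¹ * (U ⟨(zs i).shift τ, κ⟩ * (W ⟨(zs i).shift τ, κ⟩)⁻¹) *
                (U ⟨(zs i).shift τ, κ⟩ * U ⟨((zs i).shift τ).shift κ, e⟩ * (U ⟨((zs i).shift τ).shift e, κ⟩)⁻¹ * (U ⟨(zs i).shift τ, e⟩)⁻¹ *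
                  U ⟨(zs i).shift τ, e⟩))) +
            dist1 ((U ⟨zs i, κ⟩ * U ⟨(zs i).shift κ, e⟩ * (U ⟨(zs i).shift e, κ⟩)⁻¹ * (U ⟨zs i, e⟩)⁻¹)⁻¹ *
              (W ⟨zs i, κ⟩ * W ⟨(zs i).shift κ, e⟩ * (W ⟨(zs i).shift e, κ⟩)⁻¹ * (W ⟨zs i, e⟩)⁻¹)) +
            dist1 ((U ⟨(zs i).shift τ, κ⟩ * U ⟨((zs i).shift τ).shift κ, e⟩ * (U ⟨((zs i).shift τ).shift e, κ⟩)⁻¹ * (U ⟨(zs i).shift τ, e⟩)⁻¹)⁻¹ *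
              (W ⟨(zs i).shift τ, κ⟩ * W ⟨((zs i).shift τ).shift κ, e⟩ * (W ⟨((zs i).shift τ).shift e, κ⟩)⁻¹ * (W ⟨(zs i).shift τ, e⟩)⁻¹))) := by
  induction k with
  | zero => simp [hX0]
  | succ k ih =>
    -- the far rungs of the square at `zs k` are the rungs at `zs (k+1)`; the induced transport is `X (k+1)`
    rw [sum_range_succ, hzs k, hX k, ← Site.shift_comm (zs k) τ κ]
    have hstep := dist1_farRungPair_le W U (zs k) κ e τ (X k)
    linarith

/-! ## §3 The run with an arbitrary far transport -/

/-- ★ **THE RUN, ANY FAR TRANSPORT**: §2 followed by §1 — for any `P′`, the far pair transported by `P′` is bounded by the same right-hand side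
`+ 2·dist1 (P′·(X k)⁻¹)·dist1 (r′_k)` under `hcomm`. [folklore] -/
theorem dist1_rungPair_run_le_of_transport (hcomm : ∀ g h : G, dist1 (g * h * g⁻¹ * h⁻¹) ≤ 2 * dist1 g * dist1 h)
    (W U : GaugeField P j G) (κ e τ : Fin P.d) (zs : ℕ → Site P j) (hzs : ∀ i, zs (i + 1) = (zs i).shift κ)
    (Y : G) (X : ℕ → G) (hX0 : X 0 = Y) (hX : ∀ i, X (i + 1) = (W ⟨(zs i).shift e, κ⟩)⁻¹ * X i * W ⟨((zs i).shift τ).shift e, κ⟩) (k : ℕ) (P' : G) :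
    dist1 (P' * ((U ⟨(zs k).shift τ, e⟩)⁻¹ * W ⟨(zs k).shift τ, e⟩) * P'⁻¹ * ((U ⟨zs k, e⟩)⁻¹ * W ⟨zs k, e⟩)⁻¹) ≤
      dist1 (Y * ((U ⟨(zs 0).shift τ, e⟩)⁻¹ * W ⟨(zs 0).shift τ, e⟩) * Y⁻¹ * ((U ⟨zs 0, e⟩)⁻¹ * W ⟨zs 0, e⟩)⁻¹) +
        ∑ i ∈ range k,
          (dist1 ((W ⟨(zs i).shift e, κ⟩ * (U ⟨(zs i).shift e, κ⟩)⁻¹) *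
              ((U ⟨zs i, κ⟩ * U ⟨(zs i).shift κ, e⟩ * (U ⟨(zs i).shift e, κ⟩)⁻¹ * (U ⟨zs i, e⟩)⁻¹ * U ⟨zs i, e⟩)⁻¹ * (U ⟨zs i, κ⟩ * (W ⟨zs i, κ⟩)⁻¹) *
                (U ⟨zs i, κ⟩ * U ⟨(zs i).shift κ, e⟩ * (U ⟨(zs i).shift e, κ⟩)⁻¹ * (U ⟨zs i, e⟩)⁻¹ * U ⟨zs i, e⟩))) +
            dist1 ((W ⟨((zs i).shift τ).shift e, κ⟩ * (U ⟨((zs i).shift τ).shift e, κ⟩)⁻¹) *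
              ((U ⟨(zs i).shift τ, κ⟩ * U ⟨((zs i).shift τ).shift κ, e⟩ * (U ⟨((zs i).shift τ).shift e, κ⟩)⁻¹ * (U ⟨(zs i).shift τ, e⟩)⁻¹ *
                    U ⟨(zs i).shift τ, e⟩)⁻¹ * (U ⟨(zs i).shift τ, κ⟩ * (W ⟨(zs i).shift τ, κ⟩)⁻¹) *
                (U ⟨(zs i).shift τ, κ⟩ * U ⟨((zs i).shift τ).shift κ, e⟩ * (U ⟨((zs i).shift τ).shift e, κ⟩)⁻¹ * (U ⟨(zs i).shift τ, e⟩)⁻¹ *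
                  U ⟨(zs i).shift τ, e⟩))) +
            dist1 ((U ⟨zs i, κ⟩ * U ⟨(zs i).shift κ, e⟩ * (U ⟨(zs i).shift e, κ⟩)⁻¹ * (U ⟨zs i, e⟩)⁻¹)⁻¹ *
              (W ⟨zs i, κ⟩ * W ⟨(zs i).shift κ, e⟩ * (W ⟨(zs i).shift e, κ⟩)⁻¹ * (W ⟨zs i, e⟩)⁻¹)) +
            dist1 ((U ⟨(zs i).shift τ, κ⟩ * U ⟨((zs i).shift τ).shift κ, e⟩ * (U ⟨((zs i).shift τ).shift e, κ⟩)⁻¹ * (U ⟨(zs i).shift τ, e⟩)⁻¹)⁻¹ *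
              (W ⟨(zs i).shift τ, κ⟩ * W ⟨((zs i).shift τ).shift κ, e⟩ * (W ⟨((zs i).shift τ).shift e, κ⟩)⁻¹ * (W ⟨(zs i).shift τ, e⟩)⁻¹))) +
        2 * dist1 (P' * (X k)⁻¹) * dist1 ((U ⟨(zs k).shift τ, e⟩)⁻¹ * W ⟨(zs k).shift τ, e⟩) := by
  have h1 := dist1_transport_change hcomm P' (X k) ((U ⟨(zs k).shift τ, e⟩)⁻¹ * W ⟨(zs k).shift τ, e⟩) ((U ⟨zs k, e⟩)⁻¹ * W ⟨zs k, e⟩)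
  have h2 := dist1_rungPair_run_le W U κ e τ zs hzs Y X hX0 hX k
  linarith

end Summit.QuantumFields.YangMills.Theorems.FluctuationComparisonRegPrIntLS2BetaRelativeLadderVarRun
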